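import Literature.NumberTheory.Sieve.FriedlanderIwaniecPrimesPoisson
import Mathlib.Analysis.SpecialFunctions.SmoothTransition
import Mathlib.Analysis.Complex.OperatorNorm
import HarnessLib

/-!
# Friedlander–Iwaniec, *The polynomial `X² + Y⁴` captures its primes*, §3: the smooth cut-off of Lemma 3.1

Family `parity`, statement parity.S17. Source: J. Friedlander, H. Iwaniec, Ann. of Math. (2) 148
(1998), 945–1040 [FriedlanderIwaniecAnnals1998], §3, proof of Lemma 3.1 (arXiv pp. 11–13):
"We begin by smoothing the sum `A_d(x)` with a function `f(u)` supported on `[0, x]` such that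
`f(u) = 1` if `0 < u ≤ x - y`, `f⁽ʲ⁾(u) ≪ y⁻ʲ` if `x - y < u < x` … For positive frequencies `k`
we shall estimate `I(k, b; d)` by repeated partial integration. We have
`∂ʲ/∂tʲ f(t² + b²) = ∑_{0 ≤ 2i ≤ j} c_{ij} t^{j-2i} f^{(j-i)}(t² + b²) ≪ (√x/y)ʲ` …
`I(k, b; d) = √x k⁻¹ ∫₀^∞ f(xt²k⁻² + b²) cos(2πt√x/d) dt` by changing the variable `t` into `t√x/k`."

This file constructs the cut-off concretely and PROVES the estimates FI use:

* `fiCutoff x y u = ψ((x - u)/y)` with `ψ = Real.smoothTransition` (smooth, values in `[0, 1]`,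
  `= 1` for `u ≤ x - y`, `= 0` for `u ≥ x`);
* `fiProfile x y h t = fiCutoff x y (t² + h)` — FI's `t ↦ f(t² + b²)` with `h = b² = c⁴ ≥ 0` —
  and its complexification `fiProfileC`; smooth, supported in `[-√x, √x]`, values in `[0, 1]`;
* `exists_bound_iteratedFDeriv_smoothTransition`: the derivatives of `ψ` of order `≤ n` are
  bounded (by compactness of `[0, 1]`);
* **`norm_iteratedDeriv_fiProfile_le`**: `|∂ⁿ/∂tⁿ f(t² + h)| ≤ n! Mₙ (2√x/y)ⁿ` for `0 < y ≤ x`,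
  `1 ≤ x` (Mathlib's Faà di Bruno bound `norm_iteratedFDeriv_comp_le` with the inner map
  `t ↦ (x - h - t²)/y`, whose derivatives are `2|t|/y ≤ 2√x/y`, `2/y ≤ (2√x/y)²`, `0`), hence
  `∫ |∂ⁿ f(t² + h)| dt ≤ 2√x · n! Mₙ (2√x/y)ⁿ` (`integral_norm_iteratedDeriv_fiProfile_le`), the
  `L¹`-bounds `‖F‖₁ ≤ 2√x`, and with `FriedlanderIwaniecPrimesPoisson` the pointwise and tail bounds
  for `𝓕F(k/d)`;
* `fourier_fiProfileC_div` (the change of variables `t ↦ t√x/k`):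
  `𝓕F(k/d) = (√x/k) ∫ f(xs²/k² + h) e(-s√x/d) ds` for `k > 0`.

## References

* J. Friedlander, H. Iwaniec, Ann. of Math. (2) 148 (1998), 945–1040, §3, proof of Lemma 3.1.
  [cite: FriedlanderIwaniecAnnals1998, §3, proof of Lemma 3.1, (3.10)-(3.13)]

## Mathlib search

Mathlib: `Real.smoothTransition` (`.contDiff`, `.zero_of_nonpos`, `.one_of_one_le`, `.nonneg`,
`.le_one`), `norm_iteratedFDeriv_comp_le`, `norm_iteratedFDeriv_eq_norm_iteratedDeriv`,
`Filter.EventuallyEq.iteratedDeriv_eq`, `IsCompact.exists_bound_of_continuousOn`,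
`HasCompactSupport.intro`, `MeasureTheory.Measure.integral_comp_mul_left`,
`MeasureTheory.norm_setIntegral_le_of_norm_le_const`. No smooth cut-off adapted to `t ↦ f(t² + h)`
exists in Mathlib or the tree.
-/

noncomputable section

open Real MeasureTheory Filter Complex Set
open scoped FourierTransform Topology ContDiff

namespace Literature.NumberTheory.Sieve.FriedlanderIwaniecPrimes

/-! ### Bounds for the derivatives of `Real.smoothTransition` -/

/-- Outside `[0, 1]` the transition function is locally constant, so its derivatives of positive
order vanish there. [folklore] -/
theorem iteratedDeriv_smoothTransition_eq_zero {i : ℕ} (hi : 1 ≤ i) {s : ℝ} (hs : s < 0 ∨ 1 < s) :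
    iteratedDeriv i Real.smoothTransition s = 0 := by
  rcases hs with hs | hs
  · have h : Real.smoothTransition =ᶠ[𝓝 s] fun _ => (0 : ℝ) := by
      filter_upwards [Iio_mem_nhds hs] with u hu
      exact Real.smoothTransition.zero_of_nonpos (le_of_lt hu)
    rw [h.iteratedDeriv_eq, iteratedDeriv_const, if_neg (by omega)]
  · have h : Real.smoothTransition =ᶠ[𝓝 s] fun _ => (1 : ℝ) := by
      filter_upwards [Ioi_mem_nhds hs] with u hu
      exact Real.smoothTransition.one_of_one_le (le_of_lt hu)
    rw [h.iteratedDeriv_eq, iteratedDeriv_const, if_neg (by omega)]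

/-- **The derivatives of `ψ = Real.smoothTransition` of order `≤ n` are uniformly bounded**: there
is `Mₙ ≥ 1` with `‖ψ⁽ⁱ⁾(s)‖ ≤ Mₙ` for all `i ≤ n` and all `s` (continuity on the compact `[0, 1]`,
vanishing of `ψ⁽ⁱ⁾`, `i ≥ 1`, outside it, and `0 ≤ ψ ≤ 1`). [folklore] -/
theorem exists_bound_iteratedFDeriv_smoothTransition (n : ℕ) :
    ∃ M : ℝ, 1 ≤ M ∧ ∀ i ≤ n, ∀ s : ℝ, ‖iteratedFDeriv ℝ i Real.smoothTransition s‖ ≤ M := by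
  -- a bound for each order on `[0, 1]`
  have hb : ∀ i : ℕ, ∃ C : ℝ, ∀ s ∈ Icc (0 : ℝ) 1, ‖iteratedDeriv i Real.smoothTransition s‖ ≤ C :=
    fun i => isCompact_Icc.exists_bound_of_continuousOn
      ((Real.smoothTransition.contDiff (n := ⊤)).continuous_iteratedDeriv i
        (by exact_mod_cast le_top)).continuousOn
  choose C hC using hb
  refine ⟨1 + ∑ i ∈ Finset.range (n + 1), |C i|,
    le_add_of_nonneg_right (Finset.sum_nonneg fun _ _ => abs_nonneg _), fun i hi s => ?_⟩
  rw [norm_iteratedFDeriv_eq_norm_iteratedDeriv]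
  have hCi : |C i| ≤ ∑ j ∈ Finset.range (n + 1), |C j| :=
    Finset.single_le_sum (f := fun j => |C j|) (fun _ _ => abs_nonneg _)
      (Finset.mem_range.mpr (by omega))
  by_cases hs : s ∈ Icc (0 : ℝ) 1
  · calc ‖iteratedDeriv i Real.smoothTransition s‖ ≤ C i := hC i s hs
      _ ≤ |C i| := le_abs_self _
      _ ≤ 1 + ∑ j ∈ Finset.range (n + 1), |C j| := by linarith [hCi]
  · rw [mem_Icc, not_and_or, not_le, not_le] at hs
    rcases Nat.eq_zero_or_pos i with rfl | hi0
    · rw [iteratedDeriv_zero, Real.norm_eq_abs, abs_of_nonneg (Real.smoothTransition.nonneg s)]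
      have := Real.smoothTransition.le_one s
      have : 0 ≤ ∑ j ∈ Finset.range (n + 1), |C j| := Finset.sum_nonneg fun _ _ => abs_nonneg _
      linarith
    · rw [iteratedDeriv_smoothTransition_eq_zero hi0 hs, norm_zero]
      positivity

/-! ### The cut-off `f` and the profile `t ↦ f(t² + h)` -/

/-- FI's cut-off: `f(u) = ψ((x - u)/y)`, `ψ = Real.smoothTransition`; smooth, `0 ≤ f ≤ 1`, `f = 1`
on `u ≤ x - y` and `f = 0` on `u ≥ x` ("`f(u) = 1` if `0 < u ≤ x - y`, `f⁽ʲ⁾(u) ≪ y⁻ʲ` if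
`x - y < u < x`", supported on `u ≤ x`). [cite: FriedlanderIwaniecAnnals1998, §3, proof of Lemma 3.1 (the function f)] -/
def fiCutoff (x y u : ℝ) : ℝ := Real.smoothTransition ((x - u) / y)

/-- `fiCutoff` unfolded. [cite: FriedlanderIwaniecAnnals1998, §3, proof of Lemma 3.1] -/
theorem fiCutoff_def (x y u : ℝ) : fiCutoff x y u = Real.smoothTransition ((x - u) / y) := rfl

/-- `0 ≤ f ≤ 1`. [folklore] -/
theorem fiCutoff_mem_Icc (x y u : ℝ) : fiCutoff x y u ∈ Icc (0 : ℝ) 1 :=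
  ⟨Real.smoothTransition.nonneg _, Real.smoothTransition.le_one _⟩

/-- `f(u) = 1` for `u ≤ x - y` (`y > 0`). [cite: FriedlanderIwaniecAnnals1998, §3, proof of Lemma 3.1] -/
theorem fiCutoff_eq_one {x y u : ℝ} (hy : 0 < y) (hu : u ≤ x - y) : fiCutoff x y u = 1 :=
  Real.smoothTransition.one_of_one_le ((one_le_div hy).mpr (by linarith))

/-- `f(u) = 0` for `u ≥ x` (`y > 0`). [cite: FriedlanderIwaniecAnnals1998, §3, proof of Lemma 3.1] -/
theorem fiCutoff_eq_zero {x y u : ℝ} (hy : 0 < y) (hu : x ≤ u) : fiCutoff x y u = 0 :=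
  Real.smoothTransition.zero_of_nonpos (div_nonpos_of_nonpos_of_nonneg (by linarith) hy.le)

/-- `f` is smooth. [folklore] -/
theorem contDiff_fiCutoff (x y : ℝ) : ContDiff ℝ ∞ (fiCutoff x y) :=
  Real.smoothTransition.contDiff.comp ((contDiff_const.sub contDiff_id).div_const y)

/-- `f` is continuous. [folklore] -/
theorem continuous_fiCutoff (x y : ℝ) : Continuous (fiCutoff x y) := (contDiff_fiCutoff x y).continuous

/-- FI's profile `t ↦ f(t² + h)` (`h = b² = c⁴`), as a complex-valued function of `t` (the function
to which Poisson summation is applied in (3.11)). [cite: FriedlanderIwaniecAnnals1998, §3 (3.11)] -/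
def fiProfileC (x y h : ℝ) (t : ℝ) : ℂ := (fiCutoff x y (t ^ 2 + h) : ℂ)

/-- `fiProfileC` unfolded. [cite: FriedlanderIwaniecAnnals1998, §3 (3.11)] -/
theorem fiProfileC_apply (x y h t : ℝ) : fiProfileC x y h t = (fiCutoff x y (t ^ 2 + h) : ℂ) := rfl

/-- The complexified transition function `ψ_ℂ = ofReal ∘ ψ`. [folklore] -/
def smoothTransitionC (s : ℝ) : ℂ := (Real.smoothTransition s : ℂ)

/-- `ψ_ℂ` is smooth. [folklore] -/
theorem contDiff_smoothTransitionC : ContDiff ℝ ∞ smoothTransitionC :=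
  ofRealCLM.contDiff.comp Real.smoothTransition.contDiff

/-- The derivative bounds of `ψ` transfer to `ψ_ℂ` (`‖ofReal‖ = 1`). [folklore] -/
theorem norm_iteratedFDeriv_smoothTransitionC_le {n : ℕ} {M : ℝ}
    (hM : ∀ i ≤ n, ∀ s : ℝ, ‖iteratedFDeriv ℝ i Real.smoothTransition s‖ ≤ M) :
    ∀ i ≤ n, ∀ s : ℝ, ‖iteratedFDeriv ℝ i smoothTransitionC s‖ ≤ M := by
  intro i hi s
  have h := ContinuousLinearMap.iteratedFDeriv_comp_left (x := s) (i := i) ofRealCLM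
    ((Real.smoothTransition.contDiff (n := ⊤)).contDiffAt) (by exact_mod_cast le_top)
  have hfun : smoothTransitionC = ⇑ofRealCLM ∘ Real.smoothTransition := rfl
  rw [hfun, h]
  refine (ContinuousLinearMap.norm_compContinuousMultilinearMap_le _ _).trans ?_
  rw [_root_.Complex.ofRealCLM_norm, one_mul]
  exact hM i hi s

/-- The inner map `q(t) = (x - h - t²)/y`. [folklore] -/
def fiInner (x y h : ℝ) (t : ℝ) : ℝ := (x - h - t ^ 2) / y

/-- The profile is `ψ_ℂ ∘ q`. [cite: FriedlanderIwaniecAnnals1998, §3, proof of Lemma 3.1] -/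
theorem fiProfileC_eq_comp (x y h : ℝ) : fiProfileC x y h = smoothTransitionC ∘ fiInner x y h := by
  funext t
  simp only [fiProfileC, fiCutoff, smoothTransitionC, fiInner, Function.comp_apply]
  congr 2
  ring

/-- `q` is smooth. [folklore] -/
theorem contDiff_fiInner (x y h : ℝ) : ContDiff ℝ ∞ (fiInner x y h) := by
  unfold fiInner
  exact ((contDiff_const.sub (contDiff_id.pow 2)).div_const y)

/-- `q'(t) = -2t/y`. [folklore] -/
theorem deriv_fiInner (x y h : ℝ) : deriv (fiInner x y h) = fun t => -2 * t / y := by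
  funext t
  unfold fiInner
  simp only [deriv_div_const, deriv_const_sub, differentiableAt_fun_id, deriv_fun_pow,
    Nat.cast_ofNat, Nat.add_one_sub_one, pow_one, deriv_id'', mul_one]
  ring

/-- `q''(t) = -2/y`. [folklore] -/
theorem iteratedDeriv_two_fiInner (x y h : ℝ) : iteratedDeriv 2 (fiInner x y h) = fun _ => -2 / y := by
  rw [show (2 : ℕ) = 1 + 1 from rfl, iteratedDeriv_succ', iteratedDeriv_one, deriv_fiInner,
    show (fun t : ℝ => -2 * t / y) = fun t => (-2 / y) * t by funext t; ring,
    deriv_const_mul_field', deriv_id'']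
  funext t
  ring

/-- `q⁽ⁱ⁾ = 0` for `i ≥ 3`. [folklore] -/
theorem iteratedDeriv_fiInner_eq_zero (x y h : ℝ) (i : ℕ) :
    iteratedDeriv (i + 3) (fiInner x y h) = fun _ => 0 := by
  induction i with
  | zero =>
      rw [show (0 + 3 : ℕ) = 2 + 1 from rfl, iteratedDeriv_succ, iteratedDeriv_two_fiInner]
      funext t
      simp
  | succ i ih =>
      rw [show i + 1 + 3 = (i + 3) + 1 by ring, iteratedDeriv_succ, ih]
      funext t
      simp

/-- **The derivatives of the inner map are dominated by powers of `2√x/y`** on `|t| ≤ √x`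
(`0 < y ≤ x`): `‖q⁽ⁱ⁾(t)‖ ≤ (2√x/y)ⁱ` for `i ≥ 1`. [folklore] -/
theorem norm_iteratedFDeriv_fiInner_le {x y h t : ℝ} (hy : 0 < y) (hyx : y ≤ x)
    (ht : |t| ≤ Real.sqrt x) {i : ℕ} (hi : 1 ≤ i) :
    ‖iteratedFDeriv ℝ i (fiInner x y h) t‖ ≤ (2 * Real.sqrt x / y) ^ i := by
  have hx0 : 0 ≤ x := hy.le.trans hyx
  rw [norm_iteratedFDeriv_eq_norm_iteratedDeriv]
  rcases Nat.lt_or_ge i 3 with h3 | h3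
  · interval_cases i
    · rw [iteratedDeriv_one, deriv_fiInner]
      simp only [pow_one, Real.norm_eq_abs]
      rw [abs_div, abs_of_pos hy, abs_mul, abs_neg, abs_two]
      gcongr
    · rw [iteratedDeriv_two_fiInner]
      simp only [Real.norm_eq_abs]
      rw [abs_div, abs_neg, abs_two, abs_of_pos hy, div_pow, mul_pow, Real.sq_sqrt hx0,
        div_le_div_iff₀ hy (by positivity)]
      nlinarith
  · obtain ⟨j, rfl⟩ : ∃ j, i = j + 3 := ⟨i - 3, by omega⟩
    rw [iteratedDeriv_fiInner_eq_zero]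
    simp only [norm_zero]
    positivity

/-! ### The profile: smoothness, support, derivative and `L¹` bounds -/

/-- The profile is smooth. [folklore] -/
theorem contDiff_fiProfileC (x y h : ℝ) : ContDiff ℝ ∞ (fiProfileC x y h) := by
  rw [fiProfileC_eq_comp]
  exact contDiff_smoothTransitionC.comp (contDiff_fiInner x y h)

/-- The profile is continuous. [folklore] -/
theorem continuous_fiProfileC (x y h : ℝ) : Continuous (fiProfileC x y h) :=
  (contDiff_fiProfileC x y h).continuous

/-- `0 ≤ f(t² + h) ≤ 1`, in particular `‖F(t)‖ ≤ 1`. [folklore] -/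
theorem norm_fiProfileC_le_one (x y h t : ℝ) : ‖fiProfileC x y h t‖ ≤ 1 := by
  rw [fiProfileC_apply, Complex.norm_real, Real.norm_eq_abs,
    abs_of_nonneg (fiCutoff_mem_Icc _ _ _).1]
  exact (fiCutoff_mem_Icc _ _ _).2

/-- The profile vanishes for `|t| ≥ √x` (`h ≥ 0`, `y > 0`). [cite: FriedlanderIwaniecAnnals1998, §3, proof of Lemma 3.1] -/
theorem fiProfileC_eq_zero {x y h t : ℝ} (hy : 0 < y) (hh : 0 ≤ h) (hx : 0 ≤ x)
    (ht : Real.sqrt x ≤ |t|) : fiProfileC x y h t = 0 := by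
  rw [fiProfileC_apply, fiCutoff_eq_zero hy, Complex.ofReal_zero]
  have : x ≤ t ^ 2 := by
    calc x = Real.sqrt x ^ 2 := (Real.sq_sqrt hx).symm
      _ ≤ |t| ^ 2 := pow_le_pow_left₀ (Real.sqrt_nonneg x) ht 2
      _ = t ^ 2 := sq_abs t
  linarith

/-- The profile has compact support (in `[-√x, √x]`). [folklore] -/
theorem hasCompactSupport_fiProfileC {x y h : ℝ} (hy : 0 < y) (hh : 0 ≤ h) (hx : 0 ≤ x) :
    HasCompactSupport (fiProfileC x y h) := by
  refine HasCompactSupport.intro (isCompact_Icc : IsCompact (Icc (-Real.sqrt x) (Real.sqrt x)))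
    fun t ht => fiProfileC_eq_zero hy hh hx ?_
  rw [mem_Icc, not_and_or, not_le, not_le] at ht
  rcases ht with ht | ht
  · rw [abs_of_neg (by linarith [Real.sqrt_nonneg x])]; linarith
  · exact ht.le.trans (le_abs_self t)

/-- **The derivative bound** ("`∂ʲ/∂tʲ f(t² + b²) ≪ (√x/y)ʲ`", made explicit): for `1 ≤ x`,
`0 < y ≤ x`, `h ≥ 0` and `Mₙ` a bound for `‖ψ⁽ⁱ⁾‖`, `i ≤ n`
(`exists_bound_iteratedFDeriv_smoothTransition`): `‖∂ⁿ/∂tⁿ f(t² + h)‖ ≤ n! Mₙ (2√x/y)ⁿ` for all `t`.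
[cite: FriedlanderIwaniecAnnals1998, §3, proof of Lemma 3.1, display before (3.13)] -/
theorem norm_iteratedDeriv_fiProfileC_le {x y h : ℝ} (hy : 0 < y) (hyx : y ≤ x)
    (hh : 0 ≤ h) {n : ℕ} {M : ℝ} (hM0 : 0 ≤ M)
    (hM : ∀ i ≤ n, ∀ s : ℝ, ‖iteratedFDeriv ℝ i Real.smoothTransition s‖ ≤ M) (t : ℝ) :
    ‖iteratedDeriv n (fiProfileC x y h) t‖ ≤ n.factorial * M * (2 * Real.sqrt x / y) ^ n := by
  have hx0 : 0 ≤ x := hy.le.trans hyx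
  by_cases ht : Real.sqrt x < |t|
  · -- outside the support the profile vanishes near `t`
    have h0 : fiProfileC x y h =ᶠ[𝓝 t] fun _ => (0 : ℂ) := by
      filter_upwards [(isOpen_Ioi.preimage continuous_abs).mem_nhds ht] with u hu
      exact fiProfileC_eq_zero hy hh hx0 (le_of_lt hu)
    rw [h0.iteratedDeriv_eq, iteratedDeriv_const]
    split_ifs <;> simp only [norm_zero] <;> positivity
  · rw [not_lt] at ht
    rw [← norm_iteratedFDeriv_eq_norm_iteratedDeriv, fiProfileC_eq_comp]
    exact norm_iteratedFDeriv_comp_le (contDiff_smoothTransitionC) (contDiff_fiInner x y h)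
      (by exact_mod_cast le_top) t (norm_iteratedFDeriv_smoothTransitionC_le hM · · _)
      fun i hi1 _ => norm_iteratedFDeriv_fiInner_le hy hyx ht hi1

/-- **The `L¹` bound for the derivatives**: `∫ ‖∂ⁿ f(t² + h)‖ dt ≤ 2√x · n! Mₙ (2√x/y)ⁿ`.
[cite: FriedlanderIwaniecAnnals1998, §3, proof of Lemma 3.1] -/
theorem integral_norm_iteratedDeriv_fiProfileC_le {x y h : ℝ} (hy : 0 < y) (hyx : y ≤ x)
    (hh : 0 ≤ h) {n : ℕ} {M : ℝ} (hM0 : 0 ≤ M)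
    (hM : ∀ i ≤ n, ∀ s : ℝ, ‖iteratedFDeriv ℝ i Real.smoothTransition s‖ ≤ M) :
    ∫ t, ‖iteratedDeriv n (fiProfileC x y h) t‖ ≤
      2 * Real.sqrt x * (n.factorial * M * (2 * Real.sqrt x / y) ^ n) := by
  have hx0 : 0 ≤ x := hy.le.trans hyx
  set S : Set ℝ := Icc (-Real.sqrt x) (Real.sqrt x) with hS
  -- the derivative vanishes outside `S`
  have hzero : ∀ t ∉ S, ‖iteratedDeriv n (fiProfileC x y h) t‖ = 0 := by
    intro t ht
    have ht' : Real.sqrt x < |t| := by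
      rw [hS, mem_Icc, not_and_or, not_le, not_le] at ht
      rcases ht with ht | ht
      · rw [abs_of_neg (by linarith [Real.sqrt_nonneg x])]; linarith
      · exact ht.trans_le (le_abs_self t)
    have h0 : fiProfileC x y h =ᶠ[𝓝 t] fun _ => (0 : ℂ) := by
      filter_upwards [(isOpen_Ioi.preimage continuous_abs).mem_nhds ht'] with u hu
      exact fiProfileC_eq_zero hy hh hx0 (le_of_lt hu)
    rw [h0.iteratedDeriv_eq, iteratedDeriv_const]
    split_ifs <;> simp
  rw [← setIntegral_eq_integral_of_forall_compl_eq_zero hzero]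
  have hvol : volume S < ⊤ := by rw [hS, Real.volume_Icc]; exact ENNReal.ofReal_lt_top
  have hb := norm_setIntegral_le_of_norm_le_const hvol
    (f := fun t => ‖iteratedDeriv n (fiProfileC x y h) t‖)
    (C := n.factorial * M * (2 * Real.sqrt x / y) ^ n)
    (fun t _ => by rw [norm_norm]; exact norm_iteratedDeriv_fiProfileC_le hy hyx hh hM0 hM t)
  rw [Real.norm_of_nonneg (integral_nonneg fun _ => norm_nonneg _)] at hb
  refine hb.trans (le_of_eq ?_)
  rw [Measure.real, hS, Real.volume_Icc, ENNReal.toReal_ofReal (by linarith [Real.sqrt_nonneg x])]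
  ring

/-- **The `L¹` bound for the profile itself**: `∫ ‖f(t² + h)‖ dt ≤ 2√x`. [folklore] -/
theorem integral_norm_fiProfileC_le {x y h : ℝ} (hy : 0 < y) (hh : 0 ≤ h) (hx : 0 ≤ x) :
    ∫ t, ‖fiProfileC x y h t‖ ≤ 2 * Real.sqrt x := by
  set S : Set ℝ := Icc (-Real.sqrt x) (Real.sqrt x) with hS
  have hzero : ∀ t ∉ S, ‖fiProfileC x y h t‖ = 0 := by
    intro t ht
    rw [fiProfileC_eq_zero hy hh hx ?_, norm_zero]
    rw [hS, mem_Icc, not_and_or, not_le, not_le] at ht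
    rcases ht with ht | ht
    · rw [abs_of_neg (by linarith [Real.sqrt_nonneg x])]; linarith
    · exact ht.le.trans (le_abs_self t)
  rw [← setIntegral_eq_integral_of_forall_compl_eq_zero hzero]
  have hvol : volume S < ⊤ := by rw [hS, Real.volume_Icc]; exact ENNReal.ofReal_lt_top
  have hb := norm_setIntegral_le_of_norm_le_const hvol (f := fun t => ‖fiProfileC x y h t‖)
    (C := 1) (fun t _ => by rw [norm_norm]; exact norm_fiProfileC_le_one x y h t)
  rw [Real.norm_of_nonneg (integral_nonneg fun _ => norm_nonneg _)] at hb
  refine hb.trans (le_of_eq ?_)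
  rw [Measure.real, hS, Real.volume_Icc, ENNReal.toReal_ofReal (by linarith [Real.sqrt_nonneg x])]
  ring

/-! ### The Fourier transform of the profile -/

/-- `|𝓕F(ξ)| ≤ 2√x` for the profile `F(t) = f(t² + h)`. [folklore] -/
theorem norm_fourier_fiProfileC_le {x y h : ℝ} (hy : 0 < y) (hh : 0 ≤ h) (hx : 0 ≤ x) (ξ : ℝ) :
    ‖𝓕 (fiProfileC x y h) ξ‖ ≤ 2 * Real.sqrt x :=
  (norm_fourier_le_integral_norm _ ξ).trans (integral_norm_fiProfileC_le hy hh hx)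

/-- **The change of variables `t ↦ t√x/k`** ("`I(k, b; d) = √x k⁻¹ ∫ f(xt²k⁻² + b²) cos(2πt√x/d) dt`",
here in the complex form of Mathlib's `𝓕`): for `k > 0`, `x > 0`,
`𝓕F(k/d) = (√x/k) ∫ f(xs²/k² + h) e(-s√x/d) ds`.
[cite: FriedlanderIwaniecAnnals1998, §3, proof of Lemma 3.1, display before (3.13)] -/
theorem fourier_fiProfileC_div {x y h k : ℝ} (hx : 0 < x) (hk : 0 < k) (d : ℝ) :
    𝓕 (fiProfileC x y h) (k / d) =
      (Real.sqrt x / k : ℝ) * ∫ s : ℝ, 𝐞 (-(s * Real.sqrt x / d)) •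
        ((fiCutoff x y (x * s ^ 2 / k ^ 2 + h) : ℝ) : ℂ) := by
  have ha : 0 < Real.sqrt x / k := div_pos (Real.sqrt_pos.mpr hx) hk
  rw [Real.fourier_real_eq]
  set g : ℝ → ℂ := fun t => 𝐞 (-(t * (k / d))) • fiProfileC x y h t with hg
  have h1 : ∫ s : ℝ, g (Real.sqrt x / k * s) = |(Real.sqrt x / k)⁻¹| • ∫ t, g t :=
    Measure.integral_comp_mul_left g _
  rw [abs_of_pos (inv_pos.mpr ha), ← Complex.coe_smul, Complex.ofReal_inv] at h1
  have h2 : ∫ t, g t = ((Real.sqrt x / k : ℝ) : ℂ) * ∫ s : ℝ, g (Real.sqrt x / k * s) := by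
    rw [h1, smul_eq_mul, ← mul_assoc, mul_inv_cancel₀ (by exact_mod_cast ha.ne'), one_mul]
  rw [h2]
  congr 1
  refine integral_congr_ae (Filter.Eventually.of_forall fun s => ?_)
  simp only [hg, fiProfileC_apply]
  have hsq : (Real.sqrt x / k * s) ^ 2 + h = x * s ^ 2 / k ^ 2 + h := by
    rw [mul_pow, div_pow, Real.sq_sqrt hx.le]
    ring
  rw [hsq]
  congr 2
  rw [neg_inj]
  field_simp

end Literature.NumberTheory.Sieve.FriedlanderIwaniecPrimes
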